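import Summits.ValiantsHypothesis.ValiantsHypothesis.Theorems.GrenetZeonDualUnipotentThreeHalvesHeavyTopNilIndexCodimOne
import Summits.ValiantsHypothesis.ValiantsHypothesis.Theorems.GrenetZeonDualUnipotentThreeHalvesHeavyTopNilIndexCodimTwoPaths

/-!
# `GrenetZeon.DualUnipotentThreeHalves` (stmt-ValiantsHypothesis-24318), R2 heavy-top instrument — LEMMA T2 (d = 2), SHARPNESS:
# the patterns `𝔫 ∖ {E_{a,a+1}, E_{b,b+1}}` with `b ≥ a + 2` have codimension two in `𝔫` and nilindex `≤` size `− 2`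

Experiment cell «val-heavytop-census» (D-0160), engine seat val-htc-eng-2 g6 (MAINTENANCE idle-slot chore, kit 0).  Converse direction of
★ `strictUpper_codimTwo_of_pow_eq_zero` (`…HeavyTopNilIndexCodimTwo`): for superdiagonal indices `a + 2 ≤ b` of `(L+2) × (L+2)` matrices, the
coordinate pattern `H_a ⊓ H_b = {A ∈ 𝔫 : A_{a,a+1} = A_{b,b+1} = 0}` has dimension `C(L+2, 2) − 2` and every member satisfies `A ^ L = 0`.  Together:
the codimension-two subspaces of `𝔫_{L+2}` of nilindex `≤ L` are EXACTLY these patterns (lead CENSUS-EXTREMISERS X16 LEMMA T2; the triangularisable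
half of PREREG Q22's C2).

* `pow_apply_long_of_superdiag_eq_zero` — with `x_a = 0`, the long entries `(A ^ (a+1+i))_{0, a+2+i}` factor through `x_{a+2} ⋯ x_{a+1+i}`;
* ★ `pow_eq_zero_of_two_superdiag_eq_zero` — `x_a = x_b = 0`, `a + 2 ≤ b` ⇒ `A ^ L = 0`;
* `exists_pow_ne_zero_of_adjacent` — `H_a ⊓ H_{a+1}` contains `W` with `W ^ L ≠ 0` (adjacent units are excluded);
* `finrank_nt_inf_ker_inf_ker` — `dim (H_a ⊓ H_b) = C(L+2, 2) − 2` for `a ≠ b`.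

Honest framing: enemy-side structure for the census instrument; 0 GRID cells; nothing here proves or refutes `HeavyTopLaw`, 24318, S3b or 8062;
`VP ≠ VNP` is NOT proved.  No definitions, no named facts.  [folklore; lead CENSUS-EXTREMISERS X16 LEMMA T2; this cell]
-/

noncomputable section

-- single-conjunct layout: Sub = Summit, duplicated namespace component intended
set_option linter.dupNamespace false

namespace Summit.ValiantsHypothesis.ValiantsHypothesis.Theorems.GrenetZeon.HeavyTopNilIndexCodimTwoSharp

open Matrix
open Literature.LinearAlgebra.Matrix (IsStrictUpper)
open Literature.LinearAlgebra.Matrix.GerstenhaberNilpotentSubspace (nt mem_nt_iff_isStrictUpper finrank_nt)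
open Summit.ValiantsHypothesis.ValiantsHypothesis.Theorems.GrenetZeon.HeavyTopNilIndexCodimOne (mem_nt_inf_ker_entry nt_inf_ker_entry_lt_nt
  finrank_nt_inf_ker_entry)
open Summit.ValiantsHypothesis.ValiantsHypothesis.Theorems.GrenetZeon.HeavyTopNilIndexCodimTwoPaths (pow_apply_eq_prod_offset pow_succ_apply_long
  skipChain_isStrictUpper skipChain_superdiag_pred skipChain_superdiag_self skipChain_pow_ne_zero)

/-! ## Nilindex of the pattern -/

/-- With `x_a = A_{a,a+1} = 0` (`A ∈ 𝔫_{k+1}`), the long entries above row `a` only pick up unit steps: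
`(A ^ (a+1+i))_{0, a+2+i} = (A ^ (a+1))_{0,a+2} · ∏_{t<i} x_{a+2+t}`. [folklore] -/
theorem pow_apply_long_of_superdiag_eq_zero {k : ℕ} (A : Matrix (Fin (k + 1)) (Fin (k + 1)) ℂ) (hA : IsStrictUpper A) (a : ℕ)
    (hak : a + 2 ≤ k) (ha : A ⟨a, by omega⟩ ⟨a + 1, by omega⟩ = 0) :
    ∀ (i : ℕ) (hi : a + 2 + i ≤ k), (A ^ (a + 1 + i)) 0 ⟨a + 2 + i, by omega⟩ =
      (A ^ (a + 1)) 0 ⟨a + 2, by omega⟩ * ∏ t : Fin i, A ⟨a + 2 + t, by omega⟩ ⟨a + 2 + t + 1, by omega⟩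
  | 0, _ => by simp
  | i + 1, hi => by
    have h1 := pow_succ_apply_long A hA (a + 1 + i) (by omega)
    have hG := pow_apply_eq_prod_offset A hA 0 (a + 1 + i) (by omega)
    have e0 : (⟨0, by omega⟩ : Fin (k + 1)) = 0 := rfl
    simp only [zero_add, e0] at hG
    -- the unit-step product through `x_a` vanishes
    have hG0 : (A ^ (a + 1 + i)) 0 ⟨a + 1 + i, by omega⟩ = 0 := by
      rw [hG]
      exact Finset.prod_eq_zero (Finset.mem_univ (⟨a, by omega⟩ : Fin (a + 1 + i))) ha
    simp only [show a + 1 + i + 1 = a + 2 + i by omega, show a + 1 + i + 2 = a + 2 + i + 1 by omega] at h1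
    simp only [show a + 1 + (i + 1) = a + 2 + i by omega, show a + 2 + (i + 1) = a + 2 + i + 1 by omega,
      Fin.prod_univ_castSucc, Fin.val_castSucc, Fin.val_last]
    rw [h1, hG0, zero_mul, zero_add, pow_apply_long_of_superdiag_eq_zero A hA a hak ha i (by omega)]
    ring

/-- ★ **The pattern `H_a ⊓ H_b` (`a + 2 ≤ b`) has nilindex `≤ L`:** for `A ∈ 𝔫_{L+2}` with `A_{a,a+1} = A_{b,b+1} = 0`, `A ^ L = 0`.
(The three entries of `A ^ L` at distance `≥ L` are `∏_{t<L} x_t ∋ x_a`, `∏_{t≥1} x_t ∋ x_b`, and the long entry, which factors through `x_b` by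
`pow_apply_long_of_superdiag_eq_zero`.) [lead CENSUS-EXTREMISERS X16 LEMMA T2, converse direction; this file] -/
theorem pow_eq_zero_of_two_superdiag_eq_zero {L : ℕ} (A : Matrix (Fin (L + 1 + 1)) (Fin (L + 1 + 1)) ℂ) (hA : IsStrictUpper A)
    (a b : Fin (L + 1)) (hab : (a : ℕ) + 2 ≤ b) (ha : A a.castSucc a.succ = 0) (hb : A b.castSucc b.succ = 0) : A ^ L = 0 := by
  have hbL : (b : ℕ) ≤ L := by have := b.isLt; omega
  have ha' : A ⟨a, by omega⟩ ⟨a + 1, by omega⟩ = 0 := by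
    have e1 : a.castSucc = ⟨a, by omega⟩ := Fin.ext (by simp)
    have e2 : a.succ = ⟨a + 1, by omega⟩ := Fin.ext (by simp)
    rwa [e1, e2] at ha
  have hb' : A ⟨b, by omega⟩ ⟨b + 1, by omega⟩ = 0 := by
    have e1 : b.castSucc = ⟨b, by omega⟩ := Fin.ext (by simp)
    have e2 : b.succ = ⟨b + 1, by omega⟩ := Fin.ext (by simp)
    rwa [e1, e2] at hb
  ext r s
  rw [Matrix.zero_apply]
  by_cases hrs : (s : ℕ) < r + L
  · exact hA.pow_apply_eq_zero L r s hrs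
  have hs := s.isLt
  -- the three far entries
  by_cases hr0 : (r : ℕ) = 0
  · by_cases hsL : (s : ℕ) = L
    · -- `(0, L)`: the unit-step product contains `x_a`
      have hG := pow_apply_eq_prod_offset A hA 0 L (by omega)
      have er : (⟨0, by omega⟩ : Fin (L + 1 + 1)) = r := Fin.ext (show (0 : ℕ) = (r : ℕ) by omega)
      have es : (⟨0 + L, by omega⟩ : Fin (L + 1 + 1)) = s := Fin.ext (show 0 + L = (s : ℕ) by omega)
      rw [er, es] at hG
      rw [hG]
      have haL : (a : ℕ) < L := by omega
      refine Finset.prod_eq_zero (Finset.mem_univ (⟨a, haL⟩ : Fin L)) ?_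
      dsimp only
      have e1 : (⟨0 + (a : ℕ), by omega⟩ : Fin (L + 1 + 1)) = ⟨a, by omega⟩ := Fin.ext (by simp)
      have e2 : (⟨0 + (a : ℕ) + 1, by omega⟩ : Fin (L + 1 + 1)) = ⟨a + 1, by omega⟩ := Fin.ext (by simp)
      rw [e1, e2, ha']
    · -- `(0, L+1)`: the long entry factors through `x_b`
      have h := pow_apply_long_of_superdiag_eq_zero A hA a (by omega) ha' (L - 1 - a) (by omega)
      rw [show (a : ℕ) + 1 + (L - 1 - a) = L by omega] at h
      have er : (0 : Fin (L + 1 + 1)) = r := Fin.ext (by rw [Fin.val_zero]; omega)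
      have es : (⟨(a : ℕ) + 2 + (L - 1 - a), by omega⟩ : Fin (L + 1 + 1)) = s := Fin.ext (show (a : ℕ) + 2 + (L - 1 - a) = (s : ℕ) by omega)
      rw [er, es] at h
      rw [h]
      have hbi : (b : ℕ) - a - 2 < L - 1 - a := by omega
      refine mul_eq_zero_of_right _ (Finset.prod_eq_zero (Finset.mem_univ (⟨(b : ℕ) - a - 2, hbi⟩ : Fin (L - 1 - a))) ?_)
      dsimp only
      have e1 : (⟨(a : ℕ) + 2 + ((b : ℕ) - a - 2), by omega⟩ : Fin (L + 1 + 1)) = ⟨b, by omega⟩ :=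
        Fin.ext (show (a : ℕ) + 2 + ((b : ℕ) - a - 2) = (b : ℕ) by omega)
      have e2 : (⟨(a : ℕ) + 2 + ((b : ℕ) - a - 2) + 1, by omega⟩ : Fin (L + 1 + 1)) = ⟨b + 1, by omega⟩ :=
        Fin.ext (show (a : ℕ) + 2 + ((b : ℕ) - a - 2) + 1 = (b : ℕ) + 1 by omega)
      rw [e1, e2, hb']
  · -- `(1, L+1)`: the shifted unit-step product contains `x_b`
    have hG := pow_apply_eq_prod_offset A hA 1 L (by omega)
    have er : (⟨1, by omega⟩ : Fin (L + 1 + 1)) = r := Fin.ext (show (1 : ℕ) = (r : ℕ) by omega)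
    have es : (⟨1 + L, by omega⟩ : Fin (L + 1 + 1)) = s := Fin.ext (show 1 + L = (s : ℕ) by omega)
    rw [er, es] at hG
    rw [hG]
    have hbi : (b : ℕ) - 1 < L := by omega
    refine Finset.prod_eq_zero (Finset.mem_univ (⟨(b : ℕ) - 1, hbi⟩ : Fin L)) ?_
    dsimp only
    have e1 : (⟨1 + ((b : ℕ) - 1), by omega⟩ : Fin (L + 1 + 1)) = ⟨b, by omega⟩ := Fin.ext (show 1 + ((b : ℕ) - 1) = (b : ℕ) by omega)
    have e2 : (⟨1 + ((b : ℕ) - 1) + 1, by omega⟩ : Fin (L + 1 + 1)) = ⟨b + 1, by omega⟩ :=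
      Fin.ext (show 1 + ((b : ℕ) - 1) + 1 = (b : ℕ) + 1 by omega)
    rw [e1, e2, hb']


/-! ## Adjacent units are NOT allowed -/

/-- **Adjacent missing units do not lower the nilindex enough:** `H_a ⊓ H_{a+1}` (size `L + 2`, `a + 1 ≤ L`) contains the skip-chain witness
`W(a+1, 0) = Σ_{t ∉ {a, a+1}} E_{t,t+1} + E_{a,a+2}` with `W ^ L ≠ 0`.  So in LEMMA T2 the condition `b ≥ a + 2` is necessary and sufficient.
[lead CENSUS-EXTREMISERS X16 LEMMA T2; this file] -/
theorem exists_pow_ne_zero_of_adjacent {L : ℕ} (a b : Fin (L + 1)) (hab : (b : ℕ) = a + 1) :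
    ∃ W : Matrix (Fin (L + 1 + 1)) (Fin (L + 1 + 1)) ℂ, IsStrictUpper W ∧ W a.castSucc a.succ = 0 ∧ W b.castSucc b.succ = 0 ∧ W ^ L ≠ 0 :=
  ⟨_, skipChain_isStrictUpper L b 0, skipChain_superdiag_pred L b 0 a (by omega), skipChain_superdiag_self L b 0 b rfl,
    skipChain_pow_ne_zero L b 0⟩

/-! ## Dimension of the pattern -/

/-- `dim (H_a ⊓ H_b) = C(L+2, 2) − 2` for distinct superdiagonal indices `a ≠ b`. [folklore] -/
theorem finrank_nt_inf_ker_inf_ker {L : ℕ} (a b : Fin (L + 1)) (hab : a ≠ b) :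
    Module.finrank ℂ ↥((nt ℂ (L + 1 + 1) ⊓ LinearMap.ker (Matrix.entryLinearMap ℂ ℂ (Fin.castSucc a) (Fin.succ a))) ⊓
      LinearMap.ker (Matrix.entryLinearMap ℂ ℂ (Fin.castSucc b) (Fin.succ b))) = (L + 1 + 1).choose 2 - 2 := by
  classical
  set Ha := nt ℂ (L + 1 + 1) ⊓ LinearMap.ker (Matrix.entryLinearMap ℂ ℂ (Fin.castSucc a) (Fin.succ a)) with hHa
  set K := Ha ⊓ LinearMap.ker (Matrix.entryLinearMap ℂ ℂ (Fin.castSucc b) (Fin.succ b)) with hK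
  have hdimHa : Module.finrank ℂ Ha = (L + 1 + 1).choose 2 - 1 := finrank_nt_inf_ker_entry a
  -- the unit `E_b ∈ H_a \ K`
  set E : Matrix (Fin (L + 1 + 1)) (Fin (L + 1 + 1)) ℂ := Matrix.single (Fin.castSucc b) (Fin.succ b) (1 : ℂ) with hE
  have hEsu : IsStrictUpper E := by
    intro i j hij
    rw [hE, Matrix.single_apply, if_neg]
    rintro ⟨rfl, rfl⟩
    exact absurd hij (not_le.2 (Fin.castSucc_lt_succ (i := b)))
  have hEa : E a.castSucc a.succ = 0 := by
    rw [hE, Matrix.single_apply, if_neg]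
    rintro ⟨h1, -⟩
    exact hab (Fin.castSucc_injective _ h1).symm
  have hEHa : E ∈ Ha := (mem_nt_inf_ker_entry a E).2 ⟨hEsu, hEa⟩
  -- upper bound: `K < H_a`
  have hKlt : K < Ha := by
    refine lt_of_le_of_ne inf_le_left fun hEq => ?_
    have : E ∈ K := by rw [hEq]; exact hEHa
    rw [hK, Submodule.mem_inf, LinearMap.mem_ker, Matrix.entryLinearMap_apply, hE, Matrix.single_apply_same] at this
    exact one_ne_zero this.2
  have h1 := Submodule.finrank_lt_finrank_of_lt hKlt
  -- lower bound: `H_a ≤ K ⊔ ℂ E`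
  have hle : Ha ≤ K ⊔ Submodule.span ℂ {E} := by
    intro A hA
    have hsplit : A = (A - A b.castSucc b.succ • E) + A b.castSucc b.succ • E := by rw [sub_add_cancel]
    rw [hsplit]
    refine Submodule.add_mem _ (Submodule.mem_sup_left ?_) (Submodule.mem_sup_right (Submodule.smul_mem _ _ (Submodule.mem_span_singleton_self E)))
    rw [hK, Submodule.mem_inf, LinearMap.mem_ker, Matrix.entryLinearMap_apply]
    refine ⟨Ha.sub_mem hA (Ha.smul_mem _ hEHa), ?_⟩
    rw [Matrix.sub_apply, Matrix.smul_apply, hE, Matrix.single_apply_same, smul_eq_mul, mul_one, sub_self]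
  have h2 : Module.finrank ℂ Ha ≤ Module.finrank ℂ K + 1 := by
    calc Module.finrank ℂ Ha ≤ Module.finrank ℂ ↥(K ⊔ Submodule.span ℂ {E}) := Submodule.finrank_mono hle
      _ ≤ Module.finrank ℂ K + Module.finrank ℂ (Submodule.span ℂ {E}) := Submodule.finrank_add_le_finrank_add_finrank _ _
      _ ≤ Module.finrank ℂ K + 1 := by
          gcongr
          exact (finrank_span_le_card ({E} : Set (Matrix (Fin (L + 1 + 1)) (Fin (L + 1 + 1)) ℂ))).trans (by simp)
  omega

end Summit.ValiantsHypothesis.ValiantsHypothesis.Theorems.GrenetZeon.HeavyTopNilIndexCodimTwoSharp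

end
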